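import Summits.RiemannHypothesis.RiemannHypothesis.Theorems.LiDirichletSplit
import Mathlib.Analysis.SpecialFunctions.Gamma.Digamma
import HarnessLib

/-!
# PART F⁗′ (cell rh-li, engine seat rh-li-eng-5 gen 4) — the FIRST Dirichlet Li coefficient in closed form (RH-FREE, GRH-FREE)

Corollary of T-D2s (`liDirichletSplit_holds`) at `n = 1`: for a primitive character `χ` mod `q > 1`,

  `liCoeffCharRe χ 1 = Σ'_ρ m_χ(ρ) Re(1/ρ) = ½ log(q/π) + ½ Re ψ((1+a)/2) + Re (L′/L)(1, χ)`,

i.e. `= ½ log(q/π) − γ/2 − log 2 + Re (L′/L)(1,χ)` for EVEN `χ` (`ψ(½) = −γ − 2 log 2`) and `= ½ log(q/π) − γ/2 + Re (L′/L)(1,χ)` for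
ODD `χ` (`ψ(1) = −γ`).  This is the kernel form of the STEP-0 anchors of DATA.md §J.2(b)/(S7): e.g. for `χ₋₄` (odd, `q = 4`) the
certified table value `λ_{χ₋₄}(1) = 0.07778398996…` is `½ log(4/π) − γ/2 + (L′/L)(1, χ₋₄)` with the Kummer–Malmsten value
`(L′/L)(1,χ₋₄) = log(4π³e^γ/Γ(¼)⁴) = 0.2456095847…`; the sum over a conductor, `Σ_χ Re (L′/L)(1,χ)`, is the Euler–Kronecker-type
constant of (S7).  Classical: the `n = 1` Li coefficient is `Σ_ρ Re 1/ρ` (MV §10.2, (10.37)–(10.38): `Re B(χ) = −Σ_ρ Re 1/ρ`).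

**Nothing in this file bears on the truth of RH or GRH.**  bears_on: LADDER-RH L-D (COLUMN 4 LI, Dirichlet rows).
-/

noncomputable section

-- D-0017: `Summit.<S>.<S>.…` is the designed namespace of a single-problem summit.
set_option linter.dupNamespace false

namespace Summit.RiemannHypothesis.RiemannHypothesis.Theorems.LiTheory

open Literature.NumberTheory.LFunctions Literature.NumberTheory.LFunctions.LiDirichlet

variable {q : ℕ} [NeZero q] {χ : DirichletCharacter ℂ q}

/-- **The first Dirichlet Li coefficient** (RH-FREE): for a primitive `χ` mod `q > 1`,
`liCoeffCharRe χ 1 = ½ log(q/π) + ½ Re ψ((1+a)/2) + Re (L′/L)(1, χ)`, `a = charParity χ`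
(T-D2s at `n = 1`: `charLiTrend χ 1 = Re 𝒜_χ(0)`, `charLiOsc χ 1 = Re q₀(χ)`). [cite: Li2004, Thm 2; MontgomeryVaughan2007, (10.38)] -/
theorem liCoeffCharRe_one_eq (hχ : χ.IsPrimitive) (hq : 1 < q) :
    liCoeffCharRe χ 1 = Real.log ((q : ℝ) / Real.pi) / 2 +
      (Complex.digamma ((1 + (charParity χ : ℂ)) / 2)).re / 2 + (logDeriv χ.LFunction 1).re := by
  have h := liDirichletSplit_holds q χ hχ hq 1 le_rfl
  rw [h, charLiTrend_one, charLiOsc_one]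
  simp only [charTrendGen, charLogDerivCoeff, liMap_zero, one_pow, mul_one, iteratedDeriv_zero, Nat.factorial_zero,
    Nat.cast_one, div_one, Complex.add_re, Complex.div_ofNat_re, Complex.ofReal_re]

/-- **Even primitive `χ` mod `q > 1`**: `liCoeffCharRe χ 1 = ½ log(q/π) − log 2 − γ/2 + Re (L′/L)(1, χ)` (`ψ(½) = −2 log 2 − γ`).
[cite: Li2004, Thm 2; MontgomeryVaughan2007, (10.38)] -/
theorem liCoeffCharRe_one_eq_of_even (hχ : χ.IsPrimitive) (hq : 1 < q) (heven : χ.Even) :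
    liCoeffCharRe χ 1 = Real.log ((q : ℝ) / Real.pi) / 2 - Real.log 2 - Real.eulerMascheroniConstant / 2 +
      (logDeriv χ.LFunction 1).re := by
  rw [liCoeffCharRe_one_eq hχ hq, charParity_of_even heven, Nat.cast_zero, add_zero, Complex.digamma_one_half]
  have hl : Complex.log 2 = ((Real.log 2 : ℝ) : ℂ) := by
    rw [show (2 : ℂ) = ((2 : ℝ) : ℂ) by norm_num, ← Complex.ofReal_log (by norm_num : (0 : ℝ) ≤ 2)]
  have e : (-2 * Complex.log 2 - (Real.eulerMascheroniConstant : ℂ)).re =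
      -2 * Real.log 2 - Real.eulerMascheroniConstant := by
    rw [hl, show (-2 * ((Real.log 2 : ℝ) : ℂ) - (Real.eulerMascheroniConstant : ℂ)) =
      (((-2 * Real.log 2 - Real.eulerMascheroniConstant) : ℝ) : ℂ) by push_cast; ring, Complex.ofReal_re]
  rw [e]
  ring

/-- **Odd primitive `χ` mod `q > 1`**: `liCoeffCharRe χ 1 = ½ log(q/π) − γ/2 + Re (L′/L)(1, χ)` (`ψ(1) = −γ`).
[cite: Li2004, Thm 2; MontgomeryVaughan2007, (10.38)] -/
theorem liCoeffCharRe_one_eq_of_odd (hχ : χ.IsPrimitive) (hq : 1 < q) (hodd : χ.Odd) :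
    liCoeffCharRe χ 1 = Real.log ((q : ℝ) / Real.pi) / 2 - Real.eulerMascheroniConstant / 2 +
      (logDeriv χ.LFunction 1).re := by
  rw [liCoeffCharRe_one_eq hχ hq, charParity_of_odd hodd, Nat.cast_one, show ((1 : ℂ) + 1) / 2 = 1 by norm_num,
    Complex.digamma_one]
  simp only [Complex.neg_re, Complex.ofReal_re]
  ring

end Summit.RiemannHypothesis.RiemannHypothesis.Theorems.LiTheory

end
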